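import Summits.BirchSwinnertonDyer.Rank1Residual.Partition.MainConjecturesIrreducibleIdentityRows
import Summits.BirchSwinnertonDyer.Rank1Residual.Partition.MainConjecturesIrreducibleBDP
import Summits.BirchSwinnertonDyer.Rank1Residual.X9.LeafDischargeScalarImage
import Literature.NumberTheory.EllipticCurves.YanZhu2026.BDPMainConjectureAtTrivialCharacterOfHeegnerDivisibility
import Literature.NumberTheory.EllipticCurves.HeegnerNormPointExistenceProofs
import Literature.NumberTheory.EllipticCurves.LambdaAdicSelmerDataProofs
import Literature.NumberTheory.EllipticCurves.IwasawaSelmerDualProofs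
import Literature.NumberTheory.EllipticCurves.MatarNekovar2019.IrreducibleOverQuadraticFieldProofs
import HarnessLib

/-!
# Class X9, the HOWARD ROAD (J-free): the TWO-SIDED anticyclotomic link and the Heegner-index
# IDENTITY over `K` at EVERY Tamagawa depth, at irreducible NON-surjective image, from
# Mastella–Zerman 2026 Cor. 4.6 (Howard's Thm. B under (irr) + scalars) ∘ Yan–Zhu 2026 Thm. 5.7 (1) +
# 5.9 + BCS 2025 Prop. 4.2.2 + CGLS 2022 Thm. 5.1.3 (the composite `…_of_heegnerDivisibility`) +
# JSW 2017 Thm. 3.3.1 — NO Jetchev divisibility, NO Kolyvagin/Cha structure bound, NO (sur), NO (im)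
# (cell `bsd-print-x9`, prover seat p4 «Heegner/Kolyvagin road under irreducibility», gen 3)

HONEST FRAMING (cell `run/shared/lean/pub/bsd-print-x9/`, D-0131 print tier): THEOREMS ONLY (no
definition, no named fact, no `sorry`); every published theorem enters as one of the tree's named
Literature facts BY NAME with its printed hypotheses verbatim; every unproved statement is an
EXPLICIT binder. Nothing about any particular curve is asserted; no label changes; the leaf
`BSDpOnClassX9` is NOT closed here (this file is a `--supports` helper of the X9 Heegner crux).

## What this file does

Route `PrintX9` reaches the X9 leaf at a rank-one pair through the Heegner-index identity over a
Heegner field `K`, `2·ord_p ∏ c_ℓ(E) + ord_p #Ш(E/K) = 2·ord_p[E(K):ℤP_K]` (`X11b.IndexIdentityAt`). Its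
landed road obtains the UPPER half from Kolyvagin's structure theorem (Cha 2005 Rmk. 25) fed by the
crux J = `HeegnerDivisibilityX9` (derived Heegner points `p^s`-divisible to Tamagawa depth; after
p4 g2's Jetchev chain its only open reading is the multi-carrier regime `MultiPrimeX9`, for which no
printed source exists at any image). THIS FILE records the SECOND road to the same identity, which
uses NO Heegner-point divisibility at all: the TWO-SIDED anticyclotomic main conjecture at the
trivial character. In print (BCS 2025 Thm. 1.2.4 (b), Yan–Zhu 2026 Thm. 5.7 (1)) its integral
sentence needs a big-image hypothesis at exactly ONE place — Howard's divisibility [How04, Thm. B] —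
and the tree now holds that divisibility WITHOUT surjectivity as the published named fact
`MastellaZerman2026.cor46_howardDivisibility_of_scalarImage` (any odd `p`; (irr) + "the `p`-adic image
contains `1 + pℤ_p`", a THEOREM on X9 by Lombardo–Tronto 2022, ty2 file P `ClassX9.hasPadicScalarImage`),
and the image-free transfer as the composite named fact
`YanZhu2026.thm57_thm59_bcs422_cgls513_generator_constantCoeff_of_heegnerDivisibility` (ty1 g8,
p563407). So, exactly as the cell b2b-bsdres did for the (sur) rows
(`X11b.indexIdentityAt_of_heegner_of_thm124b_of_thm331`), we get on X9 frames:

* §1 `X11b.imcWaldspurgerOnTreeGoodAt_inducedPlace_of_heegnerContainment_of_thm331` — the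
  TWO-SIDED link `X11b.IMCWaldspurgerOnTreeGoodAt p κ (inducedPlace ι) γ ι P` at `p ≥ 3` good
  ordinary, (irr_K), `p ∤ h_K`, GRANTED Howard's containment at the frame (explicit `∃`-hypothesis,
  the composite fact's own), through the σ-bridge of `MainConjecturesIrreducibleBDP.lean` §0/§3.
* §2 `X9.heegnerContainment_of_cor46` — on an X9 pair and a Heegner frame with `p ∤ h_K` the
  containment HOLDS for the anticyclotomic datum, from Mastella–Zerman Cor. 4.6 (`h46`) via ty2's
  constructor `ClassX9.mz26Hypotheses`; the data `(jbar, 𝔖_p(K_∞), ℋ_∞, X)` EXIST by tree theorems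
  (`IsAlgClosed.lift`, `LambdaAdicSelmerDataExists.nonempty_lambdaAdicSelmerData`,
  `nonempty_heegnerFamily_of` ∘ `exists_isHeegnerNormPoint_holds`, `nonempty_selmerDualData_holds`).
* §3 `X9.indexIdentityAt_of_heegner_of_cor46_of_thm331` — the Heegner-index IDENTITY over `K` at a
  classical Manin-unit Heegner datum of a rank-one X9 pair over a Heegner field with `p` split, `d_K`
  odd `≠ −3`, `L(E^{d_K},1) ≠ 0` AND `p ∤ h_K`, from `h46`, the composite `hYZ`, JSW 3.3.1 (`h331`),
  Gross–Zagier, Kolyvagin, GZK, modularity; (irr_K) by the Matar–Nekovář THEOREM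
  `prop526_hasIrreducibleModPGaloisRep_baseChange_holds`. ANY Tamagawa numbers; no J.

What it costs compared with the J road: ONE extra frame binder, `p ∤ h_K` (Howard 2004 §3 / MZ26
Assumption 2.1 / Yan–Zhu's `Thm57Hypotheses.not_dvd_classNumber`), which the companion
`PrintX9HowardRankOne.lean` carries to the leaf as a FRAME-SUPPLY binder. «beyond-print theorem»: NO —
this is a composite of printed theorems read at the X9 image (the beyond-print content of the X9
Heegner road is p4 g2's `JET.Split.jetchevX9_of_namedFacts`).

References: [MastellaZerman2026] Ann. Math. Québec (2026) = arXiv:2505.08710, Cor. 4.6, Assumptions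
2.1/2.13; [LombardoTronto2022] PJM 320, Thm. 3.16; [YanZhu2024MainConjNonCM] J. Algebra 693 (2026)
Thm. 5.7 (1), Thm. 5.9; [BurungaleCastellaKim2021] Thm. 5.2; [BurungaleCastellaSkinner2025] Prop.
4.2.2, Thm. 4.2.1 (proof, p. 8), Cor. 1.3.1 (proof, p. 4); [CastellaGrossiLeeSkinner2022] Thm. 5.1.3;
[JetchevSkinnerWan2017] Thm. 3.3.1, §7.4.1; [Howard2004HeegnerKolyvagin] Thm. B, §3;
[MatarNekovar2019] Prop. 5.26 (2); [Castella2018] §5 (5.3); [GrossLMS1991] Conj. (2.2).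
-/

set_option linter.dupNamespace false
set_option autoImplicit false

noncomputable section

open scoped Classical

open WeierstrassCurve NumberField IsDedekindDomain Literature.NumberTheory.EllipticCurves
  Literature.NumberTheory.EllipticCurves.ModularForms
  Literature.NumberTheory.EllipticCurves.Rank1Residual
  Literature.NumberTheory.EllipticCurves.YanZhu2026
  Literature.NumberTheory.EllipticCurves.JetchevSkinnerWan2017
  Summit.BirchSwinnertonDyer.BirchSwinnertonDyer.Theorems.Rank1ResidualX1Defs

namespace Summit.BirchSwinnertonDyer.Rank1Residual

/-! ### §1 The TWO-SIDED link in the JSW letter from the composite fact, granted Howard's containment -/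

namespace X11b

section IMC

variable {W : WeierstrassCurve ℚ} [W.IsElliptic] [W.IsGloballyMinimal] {p : ℕ} [Fact p.Prime]
  {K : Type} [Field K] [NumberField K]

/-- **(IMC∘BDP)ᵍ, TWO-SIDED, in the JSW / Castella letter `IMCWaldspurgerOnTreeGoodAt p κ (inducedPlace ι)
γ ι P`, at a good ordinary `p ≥ 3` with (irr_K) and `p ∤ h_K`, NO image hypothesis, GRANTED Howard's
containment `Char(S_ord/Λκ)² ⊆ Char(𝒳_ord,tor)` at the frame** — from the composite named fact
`YanZhu2026.thm57_thm59_bcs422_cgls513_generator_constantCoeff_of_heegnerDivisibility` (Yan–Zhu 2026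
Thm. 5.7 (1) rational + Thm. 5.9 transfer + BCS 2025 Prop. 4.2.2 + CGLS 2022 Thm. 5.1.3) and JSW 2017
Thm. 3.3.1 (`h331`, the generator with non-zero constant term at `(ι, inducedPlace ι)`), through the
σ-bridge (`exists_involutive_comp_eq`, `padicLogOrd_comp_eq_of_rank_one`): the composite at the OTHER
embedding `embAt w`, strict prime `inducedPlace ι`, and `ord_p log_{embAt w} P = ord_p log_ι P` in rank
one. The X9/X10b twin of `imcWaldspurgerOnTreeGoodAt_inducedPlace_of_thm124b_of_thm331` ((sur) there ↦
the containment hypothesis `hHow` here). The Manin term vanishes as `p ∤ c(Dt)`.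
[cite: YanZhu2024MainConjNonCM, Thm. 5.7 (1) and Thm. 5.9] [cite: BurungaleCastellaSkinner2025, Prop. 4.2.2, Thm. 4.2.1 (proof, p. 8)]
[cite: CastellaGrossiLeeSkinner2022, Thm. 5.1.3] [cite: JetchevSkinnerWan2017, Thm. 3.3.1, §2.3.2]
[cite: Castella2018, Thm. 2.3, §5 (eq:IMC+BDP)] -/
theorem imcWaldspurgerOnTreeGoodAt_inducedPlace_of_heegnerContainment_of_thm331
    (hYZ : thm57_thm59_bcs422_cgls513_generator_constantCoeff_of_heegnerDivisibility)
    (h331 : thm331_anticyclotomicControl)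
    (hp : 3 ≤ p) (hord : GoodOrd W p)
    (hK : IsImaginaryQuadratic K) (hodd : Odd (NumberField.discr K)) (h3 : NumberField.discr K ≠ -3)
    {N : ℕ} [NeZero N] (hN : W.conductorNorm ℤ = N) (hHN : SatisfiesHeegnerHypothesis N K)
    (hHp : SatisfiesHeegnerHypothesis p K) (hirrK : (W.baseChange K).HasIrreducibleModPGaloisRep p)
    (hhK : ¬ p ∣ NumberField.classNumber K)
    (ι : K →+* ℚ_[p]) (κ : ZpExtension K p) (hκ : κ.IsAnticyclotomic)
    (γ : Field.absoluteGaloisGroup K) [Fact (κ.IsTopGenerator γ)]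
    (Dt : ModularParametrizationData W N) (hc : ¬ (p : ℤ) ∣ Dt.c)
    (H : HeegnerDatum N (NumberField.discr K)) (ιC : K →+* ℂ) (P : (W.baseChange K).toAffine.Point)
    (hP : WeierstrassCurve.Affine.Point.map ιC.toRatAlgHom P = heegnerPointComplex Dt H)
    (hrk : (W.baseChange K).mordellWeilRank = 1)
    (hfinp : Finite (AddCommGroup.primaryComponent (W.baseChange K).sha p))
    (hPinf : ¬ IsOfFinAddOrder P)
    (hHow : ∃ (jbar : AlgebraicClosure K →+* ℂ) (D : (W.baseChange K).LambdaAdicSelmerData κ γ)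
      (F : HeegnerFamily N W K κ jbar) (X : (W.baseChange K).SelmerDualData κ γ),
      heegnerCharIdeal D F ^ 2 ≤
        Module.charIdeal (IwasawaAlgebra p) (Submodule.torsion (IwasawaAlgebra p) X.X)) :
    IMCWaldspurgerOnTreeGoodAt p κ (inducedPlace ι) γ ι P := by
  have hHN' : SatisfiesHeegnerHypothesis (W.conductorNorm ℤ) K := by rw [hN]; exact hHN
  -- the other prime `w` above `p`, of degree one, and THE embedding at it
  obtain ⟨w, hw, hwne⟩ := exists_other_prime hHp (inducedPlace ι) (natCast_mem_inducedPlace ι)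
  have hsplit : SplitsIn K p := hHp p Fact.out (dvd_refl p)
  obtain ⟨he, hf⟩ := degreeOne_of_splitsIn hK.1 hsplit hw
  set ιw : K →+* ℚ_[p] := embAt K p w hw he hf with hιw
  -- a generator with non-zero constant term of the module strict at `v = inducedPlace ι`, from JSW
  obtain ⟨-, F, hF, hF0, -⟩ := h331 W p hp hord.1 K hK hHp hHN' hirrK ι (inducedPlace ι)
    (mem_inducedPlace_iff ι) κ hκ γ hrk hfinp P hPinf
  -- the composite at the embedding `ιw` (inducing `w`), strict prime `inducedPlace ι`
  obtain ⟨n, hn, hval⟩ := hasCharValuationAt_of_heegnerDivisibility hYZ hp hord K hK hHN' hHp hodd h3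
    hirrK hhK ιw w (inducedPlace ι) (mem_asIdeal_iff_norm_embAt_lt_one w hw he hf)
    (natCast_mem_inducedPlace ι) (fun h ↦ hwne h.symm) κ hκ γ Dt H ιC P hP hHow F hF hF0
  -- `ιw = ι ∘ σ` for an involution `σ`; the log valuations agree in rank one
  obtain ⟨σ, hσ, hισ⟩ := exists_involutive_comp_eq hK.1 ι ιw
  have hlog : Literature.NumberTheory.EllipticCurves.padicLogOrd W p ιw P = padicLogOrd W p ι P := by
    rw [← hισ, ← padicLogOrd_eq_literature]
    exact padicLogOrd_comp_eq_of_rank_one W p (by omega) σ hσ ι hrk P hPinf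
  have hc0 : padicValInt p Dt.c = 0 := padicValInt.eq_zero_of_not_dvd hc
  refine ⟨n, (AcSelmer.hasCharValuationAt_iff_literature _ p κ (inducedPlace ι) ∅ γ n).mpr hn, ?_⟩
  rw [hlog] at hval
  omega

end IMC

end X11b

/-! ### §2 Howard's containment on X9 Heegner frames with `p ∤ h_K`, from Mastella–Zerman Cor. 4.6 -/

section Containment

variable {W : WeierstrassCurve ℚ} [W.IsElliptic] [W.IsGloballyMinimal] {p : ℕ} [Fact p.Prime]
  {K : Type} [Field K] [NumberField K]

/-- **Howard's containment `Char(S_ord/Λκ)² ⊆ Char(𝒳_ord,tor)` HOLDS on an X9 pair over a Heegner field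
with `p` split, `d_K ∉ {−3, −4}` and `p ∤ h_K`, for every anticyclotomic datum `(κ, γ)`** — the
`∃`-hypothesis of the composite fact `…_of_heegnerDivisibility`, discharged from Mastella–Zerman 2026
Cor. 4.6 (`h46`; Howard's Thm. B under (irr) + "the `p`-adic image contains `1 + pℤ_p`" + non-CM, ANY
odd `p`) through ty2's constructor `ClassX9.mz26Hypotheses` (the scalar condition is the THEOREM
`ClassX9.hasPadicScalarImage`, Lombardo–Tronto 2022). The data are PRODUCED here: `jbar : K̄ → ℂ` by
`IsAlgClosed.lift`, `𝔖_p(K_∞)` by `LambdaAdicSelmerDataExists.nonempty_lambdaAdicSelmerData`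
(Perrin-Riou 1987 §0), the Heegner family `ℋ_∞` by `nonempty_heegnerFamily_of` ∘
`exists_isHeegnerNormPoint_holds` (Howard §2.7/§3.3, Gross §3, Darmon Thm. 3.6 — all PROVED), the
Selmer dual `X` by `nonempty_selmerDualData_holds` (Greenberg LNM 1716 §1). No image certificate, no
(sur). [cite: MastellaZerman2026, Cor. 4.6, Assumptions 2.1 and 2.13 (v) (arXiv:2505.08710)]
[cite: LombardoTronto2022, Thm. 3.16] [cite: Howard2004HeegnerKolyvagin, Thm. B, §2.7, §3.3]
[cite: PerrinRiou1987BSMF, §0 (p. 402)] [cite: GreenbergLNM1716, §1] -/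
theorem X9.heegnerContainment_of_cor46
    (h46 : MastellaZerman2026.cor46_howardDivisibility_of_scalarImage.{0})
    [NeZero (W.conductorNorm ℤ)]
    (hX9 : Literature.NumberTheory.EllipticCurves.Rank1Residual.ClassX9 W p)
    (hK : IsImaginaryQuadratic K) (h3 : NumberField.discr K ≠ -3) (h4 : NumberField.discr K ≠ -4)
    (hHN : SatisfiesHeegnerHypothesis (W.conductorNorm ℤ) K) (hHp : SatisfiesHeegnerHypothesis p K)
    (hhK : ¬ p ∣ NumberField.classNumber K)
    (κ : ZpExtension K p) (hκ : κ.IsAnticyclotomic)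
    (γ : Field.absoluteGaloisGroup K) (hγ : κ.IsTopGenerator γ)
    (Dt : ModularParametrizationData W (W.conductorNorm ℤ)) (H : HeegnerDatum (W.conductorNorm ℤ)
      (NumberField.discr K)) (ιC : K →+* ℂ) :
    ∃ (jbar : AlgebraicClosure K →+* ℂ) (D : (W.baseChange K).LambdaAdicSelmerData κ γ)
      (F : HeegnerFamily (W.conductorNorm ℤ) W K κ jbar) (X : (W.baseChange K).SelmerDualData κ γ),
      heegnerCharIdeal D F ^ 2 ≤
        Module.charIdeal (IwasawaAlgebra p) (Submodule.torsion (IwasawaAlgebra p) X.X) := by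
  -- the data exist
  letI : Algebra K ℂ := ιC.toAlgebra
  set jbar : AlgebraicClosure K →+* ℂ :=
    (IsAlgClosed.lift (R := K) (M := ℂ) (S := AlgebraicClosure K)).toRingHom with hjbar
  obtain ⟨D⟩ := LambdaAdicSelmerDataExists.nonempty_lambdaAdicSelmerData (W.baseChange K) p κ hγ
  obtain ⟨X⟩ := (W.baseChange K).nonempty_selmerDualData_holds κ γ hγ
  obtain ⟨F⟩ := nonempty_heegnerFamily_of (exists_isHeegnerNormPoint_holds (W.conductorNorm ℤ) W K p)
    hK hHN hX9.not_dvd_conductorNorm κ Dt H.dvd_sq_sub jbar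
  -- Mastella–Zerman Cor. 4.6 at the frame
  exact Literature.NumberTheory.EllipticCurves.YanZhu2026.heegnerContainment_of_cor46 h46
    (hX9.mz26Hypotheses κ γ hK ⟨h3, h4⟩ hHN hHp hhK hκ hγ) jbar D F X

end Containment

/-! ### §3 The Heegner-index IDENTITY over `K` at a rank-one X9 datum with `p ∤ h_K` — no J, any Tamagawa depth -/

namespace X9

section Datum

variable (W : WeierstrassCurve ℚ) [W.IsElliptic] [W.IsGloballyMinimal] (p : ℕ) [Fact p.Prime]
  (K : Type) [Field K] [NumberField K] [NeZero (W.conductorNorm ℤ)]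
  (Dt : ModularParametrizationData W (W.conductorNorm ℤ))
  (H : HeegnerDatum (W.conductorNorm ℤ) (NumberField.discr K)) (ιC : K →+* ℂ)
  (P : (W.baseChange K).toAffine.Point)

/-- **The `p`-part of BSD for `E/K` in Gross–Zagier's shape — the Heegner-index identity
`2·ord_p ∏_ℓ c_ℓ(E) + ord_p #Ш(E/K) = 2·ord_p [E(K):ℤP_K]` (`X11b.IndexIdentityAt`) — at a classical
Manin-unit Heegner datum of a rank-one X9 pair (`p ≥ 5` good ordinary, `E[p]` irreducible,
`ρ̄_{E,p}` NOT surjective, non-CM) over a Heegner field with `p` split, `d_K` odd `< −4`,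
`L(E^{d_K}, 1) ≠ 0` and `p ∤ h_K`, with NO hypothesis on the Tamagawa numbers and NO Heegner-point
divisibility input (no crux J):** Mastella–Zerman 2026 Cor. 4.6 (`h46`) supplies Howard's containment
(§2), the composite `hYZ` (Yan–Zhu 5.7 (1) + 5.9 + BCS 4.2.2 + CGLS 5.1.3) the two-sided link (§1),
JSW 2017 Thm. 3.3.1 (`h331`) the control, gen 3's bookkeeping `indexIdentityAt_of_onTreeGoodLinks_of_allSplit`
the identity; rank one and finiteness over `K` from GZK over `ℚ` at `E` and at the twist
(`mordellWeilRank_baseChange_eq_one_and_finite_sha_of_twist_L_one_ne_zero`), `P_K` non-torsion by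
Gross–Zagier, (irr_K) by Matar–Nekovář 2019 Prop. 5.26 (2) (tree THEOREM). The X9 twin of
`X11b.indexIdentityAt_of_heegner_of_thm124b_of_thm331` ((sur) ↦ X9 + `p ∤ h_K` + `h46`).
[cite: MastellaZerman2026, Cor. 4.6] [cite: YanZhu2024MainConjNonCM, Thm. 5.7 (1), Thm. 5.9]
[cite: BurungaleCastellaSkinner2025, Prop. 4.2.2, Thm. 4.2.1, proof of Cor. 1.3.1 (p. 4)]
[cite: CastellaGrossiLeeSkinner2022, Thm. 5.1.3] [cite: JetchevSkinnerWan2017, Thm. 3.3.1, §7.3.1 (eq:tamK)]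
[cite: MatarNekovar2019, Prop. 5.26 (2)] [cite: Castella2018, §5 (5.3)] [cite: GrossLMS1991, §2 Conj. (2.2)] -/
theorem indexIdentityAt_of_heegner_of_cor46_of_thm331
    (h46 : MastellaZerman2026.cor46_howardDivisibility_of_scalarImage.{0})
    (hYZ : thm57_thm59_bcs422_cgls513_generator_constantCoeff_of_heegnerDivisibility)
    (h331 : thm331_anticyclotomicControl)
    (hGZ : gross_zagier (W.conductorNorm ℤ) W K) (hKo : kolyvagin (W.conductorNorm ℤ) W K)
    (hmod : hasEntireLFunction_rat) (hGZK : rank_eq_analyticRank_of_analyticRank_le_one)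
    (hX9 : Literature.NumberTheory.EllipticCurves.Rank1Residual.ClassX9 W p) (hr : W.analyticRank = 1)
    (hK : IsImaginaryQuadratic K) (hodd : Odd (NumberField.discr K)) (hlt : NumberField.discr K < -4)
    (hHN : SatisfiesHeegnerHypothesis (W.conductorNorm ℤ) K) (hHp : SatisfiesHeegnerHypothesis p K)
    (hhK : ¬ p ∣ NumberField.classNumber K)
    (hLt : (W.quadraticTwist (NumberField.discr K : ℚ)).entireLFunction 1 ≠ 0)
    (hP : WeierstrassCurve.Affine.Point.map ιC.toRatAlgHom P = heegnerPointComplex Dt H)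
    (hc : ¬ (p : ℤ) ∣ Dt.c) : X11b.IndexIdentityAt W p K P := by
  have hpP : p.Prime := Fact.out
  have hp5 : 5 ≤ p := hX9.five_le
  have hp2 : p ≠ 2 := hX9.ne_two
  have h3 : NumberField.discr K ≠ -3 := by omega
  have h4 : NumberField.discr K ≠ -4 := by omega
  haveI : Finite (W.baseChange K).sha :=
    X11b.finite_sha_baseChange_of_heegner W (W.conductorNorm ℤ) K Dt H ιC P hGZ hKo hmod hr hK hHN hLt hP
  obtain ⟨hrQ, hShaQ⟩ := hGZK W hr.le
  rw [hr] at hrQ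
  obtain ⟨hrk, hfinp⟩ :=
    mordellWeilRank_baseChange_eq_one_and_finite_sha_of_twist_L_one_ne_zero hGZK W K hK p hrQ hShaQ
      hLt
  have hPinf : ¬ IsOfFinAddOrder P :=
    X11b.not_isOfFinAddOrder_of_heegner_of_analyticRank_eq_one W (W.conductorNorm ℤ) K Dt H ιC P hGZ
      hmod hr hK hHN hLt hP
  -- (irr_K) at this field (Matar–Nekovář Prop. 5.26 (2), a tree theorem)
  have hirrK : (W.baseChange K).HasIrreducibleModPGaloisRep p :=
    MatarNekovar2019.prop526_hasIrreducibleModPGaloisRep_baseChange_holds W K hK.1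
      (Literature.SatisfiesHeegnerHypothesis.coprime_discr hK.1 hHN) p hp2 hX9.irr
  -- the anticyclotomic datum and the embedding at a prime above `p`
  obtain ⟨κ, γ, 𝔭, hκ, hγ, h𝔭⟩ := X11b.exists_anticyclotomic_generator_prime (p := p) hK
  haveI : Fact (κ.IsTopGenerator γ) := ⟨hγ⟩
  have hsplit : X11b.SplitsIn K p := hHp p Fact.out (dvd_refl p)
  obtain ⟨he, hf⟩ := X11b.degreeOne_of_splitsIn hK.1 hsplit h𝔭
  set ι : K →+* ℚ_[p] := X11b.embAt K p 𝔭 h𝔭 he hf with hι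
  -- control (JSW 3.3.1) and the two-sided link (composite fact + MZ26 containment)
  have hCTL : X11b.ControlOnTreeGoodAt p κ (X11b.inducedPlace ι) γ ι P :=
    X11b.controlOnTreeGoodAt_of_thm331_of_inducedPlace h331 (by omega) hX9.good hK hHp rfl hHN hirrK ι
      κ hκ γ hrk hfinp P hPinf
  have hHow := X9.heegnerContainment_of_cor46 h46 hX9 hK h3 h4 hHN hHp hhK κ hκ γ hγ Dt H ιC
  have hIW : X11b.IMCWaldspurgerOnTreeGoodAt p κ (X11b.inducedPlace ι) γ ι P :=
    X11b.imcWaldspurgerOnTreeGoodAt_inducedPlace_of_heegnerContainment_of_thm331 hYZ h331 (by omega)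
      hX9.goodOrd hK hodd h3 rfl hHN hHp hirrK hhK ι κ hκ γ Dt hc H ιC P hP hrk hfinp
      hPinf hHow
  exact X11b.indexIdentityAt_of_onTreeGoodLinks_of_allSplit hK rfl hHN hIW hCTL

end Datum

end X9

end Summit.BirchSwinnertonDyer.Rank1Residual

end
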